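import Mathlib
import Summits.MatrixMultiplication.MatrixMultiplication.Theses.MatrixPointInterpolation
import Summits.MatrixMultiplication.MatrixMultiplication.Theorems.MatrixPointInterpolationWindowedKaplanskyCapelli

/-!
# Crux `TightWindows` (stmt-MatrixMultiplication-18939), line `shirshov-split` — stub
# `stub_pencilThree` (the two pencil identities at point size `3`)

Registered stub `stub_pencilThree` of the skeleton of line `shirshov-split`.  At point size
`k = 3` (order `K = 2`) the fibre-density stub hands over, at EVERY `Y ∈ V_L`
(`V_j = Masquerade.wordSpan A j`), the vanishing of all four fibre sums
`Masquerade.capRest 2 Y Z' p` (`p = 0, 1, 2, 3`) of the Cayley–Hamilton–Capelli polynomial, for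
slots `Z' 0 ∈ V_{e 0}`, `Z' 1 ∈ V_{e 1}` within budget `6L + d + e 0 + e 1 ≤ 2d`.  From these the
`k = 3` core works with the two **pencil identities** (commutator-free spelling
`[P, Y] = 0 ↔ P Y = Y P`):

* (I)  `[[Z₁,Y][Z₂,Y], Y] = 0`,
* (II) `[[Z₁,Y]·Y·[Z₂,Y], Y] = 0`.

Proof.

* Two ring identities, valid in any ring and proved by expanding the `6` signed monomials
  (`noncomm_ring`): the order-two polynomial is `P_2(y; z₁, z₂) = [[z₁,y][z₂,y], y]`
  (`capPow_two_eq`), and the fibre sum over `p = 0` is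
  `R_0(y; z₁, z₂) = ∑_{τ ∈ S{1,2,3}} sgn τ · y^{τ1} z₁ y^{τ2} z₂ y^{τ3}`
  `= y · [[z₁,y]·y·[z₂,y], y] · y` (`capRest_two_zero_eq`).
* (I) is the fibre over `Fin.last`: `R_3 = (-1)^3 P_2(Y; Z₁, Z₂)` (`Masquerade.capRest_last`).
* (II): the fibre over `0` only gives `Y · [Q, Y] · Y = 0` with `Q = [Z₁,Y]·Y·[Z₂,Y]`.  But
  `V_L ∋ 1` is a subspace, so the fibre identity also holds at the points `Y + 1`, `Y - 1` of the
  pencil `Y + t • 1 ⊆ V_L`; commutators with `Y ± 1` are commutators with `Y`, and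
  `[Z₁,Y](Y ± 1)[Z₂,Y] = Q ± [Z₁,Y][Z₂,Y]`.  The second difference of the degree-two polynomial
  `t ↦ (Y + t)·([Q,Y] + t·[[Z₁,Y][Z₂,Y],Y])·(Y + t)` at `t = -1, 0, 1` is the ring identity
  `R_0(Y+1) + R_0(Y-1) - 2 R_0(Y) = 2 [Q,Y] + 2 (P_2 Y + Y P_2)` (`capRest_two_zero_pencil`,
  `noncomm_ring`); with `R_0 ≡ 0` on `V_L` and `P_2 = 0` by (I) this reads `2 • [Q, Y] = 0`.
-/

set_option linter.dupNamespace false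
-- `MatrixMultiplication.MatrixMultiplication` is the summit/sub-problem path (D-0017)

namespace Summit.MatrixMultiplication.MatrixMultiplication.Theorems.TightWindows

open scoped BigOperators
open Summit.MatrixMultiplication.MatrixMultiplication.Theorems.Masquerade Equiv

/-! ### Two ring identities for the order-two Cayley–Hamilton–Capelli polynomial -/

/-- The order-two Cayley–Hamilton–Capelli polynomial is a commutator:
`P_2(y; z₁, z₂) = ∑_{σ ∈ S₃} sgn σ · y^{σ0} z₁ y^{σ1} z₂ y^{σ2} = [[z₁,y][z₂,y], y]`, in any ring.
[folklore] -/
theorem capPow_two_eq {R : Type*} [Ring R] (y z₁ z₂ : R) :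
    capPow 2 y ![z₁, z₂] =
      (z₁ * y - y * z₁) * (z₂ * y - y * z₂) * y - y * ((z₁ * y - y * z₁) * (z₂ * y - y * z₂)) := by
  simp only [capPow, capMon, Finset.univ_perm_fin_succ, Finset.sum_map, Fintype.sum_prod_type,
    Fin.sum_univ_succ, Finset.univ_unique, Finset.sum_singleton,
    Equiv.toEmbedding_apply, Perm.decomposeFin.symm_sign, Perm.decomposeFin_symm_apply_zero,
    Perm.decomposeFin_symm_apply_succ]
  simp [Fin.succ_zero_eq_one, swap_apply_def, Units.smul_def, List.ofFn_succ]
  noncomm_ring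

/-- The fibre sum over `p = 0` of the order-three expansion is a sandwiched commutator:
`R_0(y; z₁, z₂) = ∑_{τ ∈ S{1,2,3}} sgn τ · y^{τ1} z₁ y^{τ2} z₂ y^{τ3}`
`= y · [[z₁,y]·y·[z₂,y], y] · y`, in any ring. [folklore] -/
theorem capRest_two_zero_eq {R : Type*} [Ring R] (y z₁ z₂ : R) :
    capRest 2 y ![z₁, z₂] 0 =
      y * ((z₁ * y - y * z₁) * y * (z₂ * y - y * z₂) * y -
        y * ((z₁ * y - y * z₁) * y * (z₂ * y - y * z₂))) * y := by
  rw [capRest, sum_filter_apply_zero_eq]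
  simp only [capTail, Finset.univ_perm_fin_succ, Finset.sum_map, Fintype.sum_prod_type,
    Fin.sum_univ_succ, Finset.univ_unique, Finset.sum_singleton,
    Equiv.toEmbedding_apply, Perm.decomposeFin.symm_sign, Perm.decomposeFin_symm_apply_succ]
  simp [Fin.succ_zero_eq_one, swap_apply_def, Units.smul_def, List.ofFn_succ]
  noncomm_ring

/-- **Second difference along the pencil `y + t`.**  In any ring,
`R_0(y+1; z) + R_0(y-1; z) - 2 R_0(y; z)`
`= 2 · [[z₁,y]·y·[z₂,y], y] + 2 · (P_2(y; z) y + y P_2(y; z))`: the commutators with `y ± 1` are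
the commutators with `y`, and the `t`-linear part of `[z₁,y](y+t)[z₂,y]` is `t · [z₁,y][z₂,y]`,
whose commutator with `y` is `P_2(y; z)`. [folklore] -/
theorem capRest_two_zero_pencil {R : Type*} [Ring R] (y z₁ z₂ : R) :
    capRest 2 (y + 1) ![z₁, z₂] 0 + capRest 2 (y - 1) ![z₁, z₂] 0 - 2 • capRest 2 y ![z₁, z₂] 0 =
      2 • ((z₁ * y - y * z₁) * y * (z₂ * y - y * z₂) * y -
        y * ((z₁ * y - y * z₁) * y * (z₂ * y - y * z₂))) +
      2 • (capPow 2 y ![z₁, z₂] * y + y * capPow 2 y ![z₁, z₂]) := by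
  simp only [capRest_two_zero_eq, capPow_two_eq]
  noncomm_ring

/-! ### The pencil identities -/

/-- **Pencil identities at point size `3`** (registered stub `stub_pencilThree`).  If at every
`Y ∈ V_L` all four fibre sums `capRest 2 Y Z' p` of the Cayley–Hamilton–Capelli polynomial vanish
for slots `Z' i ∈ V_{e i}` within budget `6L + d + ∑ e i ≤ 2d`, then for `6L + d + e₁ + e₂ ≤ 2d`,
`Y ∈ V_L`, `Z₁ ∈ V_{e₁}`, `Z₂ ∈ V_{e₂}`:
(I) `[[Z₁,Y][Z₂,Y], Y] = 0` (fibre over `Fin.last`, `capRest_last` and `capPow_two_eq`) and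
(II) `[[Z₁,Y]·Y·[Z₂,Y], Y] = 0` (fibre over `0` at the three points `Y, Y + 1, Y - 1 ∈ V_L` of the
pencil through `1 ∈ V_L`, `capRest_two_zero_pencil`, and (I)). [folklore] -/
theorem stub_pencilThree : ∀ (n d L : ℕ) (A : Fin 2 → Matrix (Fin n) (Fin n) ℂ),
    (∀ (e : Fin 2 → ℕ), L * ((2 + 1) * (2 + 2) / 2) + d + ∑ i, e i ≤ 2 * d →
      ∀ Y ∈ Masquerade.wordSpan A L, ∀ (Z' : Fin 2 → Matrix (Fin n) (Fin n) ℂ),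
      (∀ i, Z' i ∈ Masquerade.wordSpan A (e i)) →
      ∀ p : Fin (2 + 2), Masquerade.capRest 2 Y Z' p = 0) →
    ∀ (e₁ e₂ : ℕ), 6 * L + d + e₁ + e₂ ≤ 2 * d → ∀ Y ∈ Masquerade.wordSpan A L,
    ∀ Z₁ ∈ Masquerade.wordSpan A e₁, ∀ Z₂ ∈ Masquerade.wordSpan A e₂,
    (Z₁ * Y - Y * Z₁) * (Z₂ * Y - Y * Z₂) * Y = Y * ((Z₁ * Y - Y * Z₁) * (Z₂ * Y - Y * Z₂)) ∧
    (Z₁ * Y - Y * Z₁) * Y * (Z₂ * Y - Y * Z₂) * Y =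
      Y * ((Z₁ * Y - Y * Z₁) * Y * (Z₂ * Y - Y * Z₂)) := by
  intro n d L A hfib e₁ e₂ hbud Y hY Z₁ hZ₁ Z₂ hZ₂
  -- budget and slots for `e := ![e₁, e₂]`, `Z' := ![Z₁, Z₂]`
  have he : L * ((2 + 1) * (2 + 2) / 2) + d + ∑ i, (![e₁, e₂] : Fin 2 → ℕ) i ≤ 2 * d := by
    norm_num [Fin.sum_univ_two]
    omega
  have hZ : ∀ i : Fin 2, (![Z₁, Z₂] : Fin 2 → Matrix (Fin n) (Fin n) ℂ) i ∈
      wordSpan A ((![e₁, e₂] : Fin 2 → ℕ) i) := by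
    intro i
    fin_cases i
    · simpa using hZ₁
    · simpa using hZ₂
  -- all four fibre sums vanish at every point of `V_L`
  have hvan : ∀ Y' ∈ wordSpan A L, ∀ p : Fin (2 + 2), capRest 2 Y' ![Z₁, Z₂] p = 0 :=
    fun Y' hY' p => hfib ![e₁, e₂] he Y' hY' ![Z₁, Z₂] hZ p
  -- (I): the fibre over `Fin.last` is `(-1)^3 • P_2(Y; Z₁, Z₂) = -[[Z₁,Y][Z₂,Y], Y]`
  have hP : capPow 2 Y ![Z₁, Z₂] = 0 := by
    have h := hvan Y hY (Fin.last (2 + 1))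
    rw [capRest_last] at h
    have : ((-1 : ℤ) ^ (2 + 1) * (-1) ^ (2 + 1)) • capPow 2 Y ![Z₁, Z₂] = 0 := by
      rw [mul_smul, h, smul_zero]
    rwa [← pow_add, ← two_mul, pow_mul, neg_one_sq, one_pow, one_smul] at this
  have hI : (Z₁ * Y - Y * Z₁) * (Z₂ * Y - Y * Z₂) * Y =
      Y * ((Z₁ * Y - Y * Z₁) * (Z₂ * Y - Y * Z₂)) := by
    rw [capPow_two_eq] at hP
    exact sub_eq_zero.1 hP
  refine ⟨hI, ?_⟩
  -- (II): the fibre over `0` at the points `Y`, `Y + 1`, `Y - 1 ∈ V_L` of the pencil `Y + t • 1`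
  have h1 : (1 : Matrix (Fin n) (Fin n) ℂ) ∈ wordSpan A L := one_mem_wordSpan A L
  have key := capRest_two_zero_pencil Y Z₁ Z₂
  rw [hvan Y hY 0, hvan (Y + 1) (Submodule.add_mem _ hY h1) 0,
    hvan (Y - 1) (Submodule.sub_mem _ hY h1) 0, hP] at key
  simp only [zero_mul, mul_zero, add_zero, smul_zero, sub_zero] at key
  have key' : (2 : ℂ) • ((Z₁ * Y - Y * Z₁) * Y * (Z₂ * Y - Y * Z₂) * Y -
      Y * ((Z₁ * Y - Y * Z₁) * Y * (Z₂ * Y - Y * Z₂))) = 0 := by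
    rw [ofNat_smul_eq_nsmul]
    exact key.symm
  exact sub_eq_zero.1 ((smul_eq_zero.1 key').resolve_left two_ne_zero)

end Summit.MatrixMultiplication.MatrixMultiplication.Theorems.TightWindows
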